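import Summits.BirchSwinnertonDyer.BirchSwinnertonDyer.Theses.InertBadSignedBranches
import Summits.BirchSwinnertonDyer.BirchSwinnertonDyer.Theorems.InertBadSignedBranchesPlusMCEtaKUpToMu
import Summits.BirchSwinnertonDyer.BirchSwinnertonDyer.Theorems.QuadraticBranchSignedControlThm74OfPoitouTateColeman
import Summits.BirchSwinnertonDyer.Rank1Residual.Additive.CyclotomicTowerSignedSelmerDual
import Literature.NumberTheory.EllipticCurves.Kobayashi2003.EtaColemanPoitouTateSequences
import Literature.NumberTheory.EllipticCurves.BurungaleTian2026.EtaSignedMainConjectureMuCriterionProofs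
import Literature.NumberTheory.EllipticCurves.Kato2004.IwasawaH1ProjZeroKernelProofs
import Literature.NumberTheory.EllipticCurves.KatoFineSelmerFiniteProofs
import Literature.NumberTheory.EllipticCurves.KatoFineSelmerDualProofs
import Literature.NumberTheory.EllipticCurves.Kato2004.IwasawaInvolutionTwistProofs
import Literature.NumberTheory.EllipticCurves.IwasawaAlgebraInvolutionFixedPrimesProofs
import HarnessLib

/-!
# Route `InertBadSignedBranches` (rung K8), crux 19223 `CccOneLawOnTypeIstarZero`, line `kato_perrin_riou_istar`:
# the `μ`-DICTIONARY between RESEARCH stub 2b `stub_katoMuEqualityIstarZero` (Kato currency for the twist `W`: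
# `μ(X₀(W/ℚ_∞)) = μ(𝐇¹_Γ(T_pW)/Λz₀)`) and the `μ`-part 19865 `PlusMCEtaKMuPart` of the ROUTE-CRUX stub
# `stub_plusMCEtaK` (Kobayashi `η`-currency for the good twin `V`: `μ(X⁺(V/K_∞)^η) = μ(Λ/(L_p⁺(V, η, X)))`),
# on the PINNED objects of Kobayashi's Coleman / Poitou–Tate package at `η` (helper `--supports …-19223`)

HONEST FRAMING (refill hand `leafhand-bsd-inertbadsignedbran-3`, LAND-ONLY): BSD is NOT proved by any of
this; nothing here closes a stub, an item or a cell; no definition, no new fact, no `sorry`; nothing is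
booked. Both statements compared are open in print ([BT26] Rem. 2.7) and stay open.

WHAT. The package `Kobayashi2003.EtaColemanPoitouTateData p K₀ η V f ϖ κ γ W I FB` (named fact
`Kobayashi2003.thm62_63_73_etaColemanPoitouTate`: Thm. 6.2/6.3/7.3 i)/Cor. 7.2 at the quadratic `η`) lives ON
THE SAME PINS as stub 2b — `I : Kato2004.IwasawaH1Data W p κ γ` (`𝐇¹(T_pV)^η = 𝐇¹_Γ(T_pW)`) and
`FB : W.FineSelmerDualData κ γ` (`X⁰(V/K_∞)^η = X₀(W/ℚ_∞)`) — and carries Kobayashi's class `z` (`Col⁺ z =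
L_p⁺(V, η, X)`, `Col⁺` injective) with the `η`-component of (7.21) `𝐇¹ → Λ → X⁺(V/K_∞)^η → X₀ → 0`. Kernel:
* §1 `𝐇¹/Λz` is torsion once `Col⁺ z ≠ 0`; equal principal ideals have the same `μ`.
* §2 `muInvariant_add_eq_of_etaColemanPoitouTate`: for a CM twin `V` (frame of 19501/19865), granted 19867's
  two published inputs (`h26` [BT26] Thm. 2.6 at `η`, `h22` [Kob03] Thm. 2.2 at `η` — used for `L_p⁺ ≠ 0` on the
  algebraic side and for the torsion of `X⁺`), for every package `P`, plus datum `D` and `Lp`: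
  **`μ(X(D)) + μ(𝐇¹_Γ(T_pW)/Λ·P.z) = μ(Λ/(Lp)) + μ(X₀(W/ℚ_∞))`** (the `μ`-shadow of
  `0 → 𝐇¹/Λz → Λ/(L_p⁺) → X⁺ → X₀ → 0`, [Kob03] proof of Thm. 7.4).
* §3 hence `μ(X(D)) = μ(Λ/(Lp)) ⟺ μ(X₀(W/ℚ_∞)) = μ(𝐇¹_Γ(T_pW)/Λ·P.z)`; BY NAME `PublishedInputsEtaUpToP →
  PlusMCEtaKMuPart →` (and `→ PlusMCEtaK →`, the registered stub verbatim, via p473177's `μ`-criterion) the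
  Kato-currency `μ`-equality for `W` AT KOBAYASHI'S CLASS; conversely that equality gives 19865 pointwise.
* §4–§5 the same in stub 2b's `Module.lengthAt … (p)` currency and keying: for every CONTRAGREDIENT
  `Y : W.FineSelmerDualData κ γ⁻¹`, `length_(p) Y.X = length_(p)(𝐇¹_Γ(T_pW) ⧸ Λ∙P.z)` (the `γ ↦ γ⁻¹` re-keying
  is the `ι`-twist, `Kato2004.fineSelmerDualData_lengthAt_inv_eq`; `ι` fixes `(p)`); keyed to the named fact,
  for every twist model `W` of `V^{(p*)}` and every pin `I` SOME Kobayashi class `z` satisfies stub 2b's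
  sentence for all `Y`.

WHAT THIS ISOLATES (repair census for the planner of record). Stub 2b quantifies over ADMISSIBLE classes `z₀`
(`Kato2004.IsAdmissibleZetaClass`: `Λˣ`-multiples of the `Ω_W`-normalised `𝐳_{γ_W}`); §5 gives its sentence at
Kobayashi's `η`-class `z`. Granted 19865 + 19867 + the package fact, stub 2b's residual content is
«`μ(𝐇¹_Γ/Λz₀) = μ(𝐇¹_Γ/Λz)` for every admissible `z₀`» — implied by «every admissible `z₀ ∈ Λˣ·z`», the
comparison of Kato's `Ω_W`-normalised zeta class of the ADDITIVE twist `W` with Kobayashi's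
`Ω_V^±`-normalised `η`-class of the good twin (write `e := μ(𝐇¹/Λz₀) − μ(𝐇¹/Λz)`; if `e ≠ 0` the two
`μ`-stubs of the line cannot both hold). That comparison (the crux's own «signed period ratio of an
additive twist») is in no source and is NOT asserted here.

References: [Kobayashi2003] Invent. Math. 152 (2003), Thm. 6.2–6.3 (p. 11), Thm. 7.3 i) (7.21), Cor. 7.2,
proof of Thm. 7.4 (p. 13), §4 (p. 8); [BurungaleTian2026] Ann. of Math. 203 (2026), Thm. 2.6, Rem. 2.7
(p. 5); [Kato2004Asterisque] §12.2 (p. 220), Conj. 12.10 (p. 224); [GreenbergLNM1716] §1 p. 60;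
[Washington1997] §13.2.
-/

set_option linter.dupNamespace false
set_option autoImplicit false

noncomputable section

open scoped Classical

open CongruenceSubgroup WeierstrassCurve Field Literature.NumberTheory.EllipticCurves
  Literature.NumberTheory.EllipticCurves.ModularForms Literature.NumberTheory.GaloisRepresentations
  ZpExtension Summit.BirchSwinnertonDyer.Rank1Residual
  Summit.BirchSwinnertonDyer.BirchSwinnertonDyer.Theses.InertBadSignedBranches

namespace Summit.BirchSwinnertonDyer.BirchSwinnertonDyer.Theorems.CccOneMuDictionaryEta

/-! ## §1 Module algebra: `H/Rz` is torsion when `H ↪ R` and the image of `z` is non-zero -/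

/-- For a domain `R`, an injective `R`-linear `c : H → R` and `z ∈ H` with `c z ≠ 0`, the quotient
`H ⧸ R∙z` is a torsion module: `c z` kills it, since `c ((c z) • x) = c ((c x) • z)`.
(Kobayashi's `𝐇¹(T)^η/Λz` with `Col⁺` injective and `Col⁺ z = L_p⁺ ≠ 0`.)
[cite: Kobayashi2003, Thm. 7.3 i) and proof of Thm. 7.4 (p. 13)] -/
theorem isTorsion_quotient_span_of_injective_of_ne_zero {R : Type*} [CommRing R] [IsDomain R]
    {H : Type*} [AddCommGroup H] [Module R H] (c : H →ₗ[R] R) (hc : Function.Injective c)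
    {z : H} (hz : c z ≠ 0) : Module.IsTorsion R (H ⧸ Submodule.span R {z}) := by
  intro m
  obtain ⟨x, rfl⟩ := Submodule.Quotient.mk_surjective (Submodule.span R {z}) m
  refine ⟨⟨c z, mem_nonZeroDivisors_of_ne_zero hz⟩, ?_⟩
  have hx : c z • x = c x • z :=
    hc (by rw [map_smul, map_smul, smul_eq_mul, smul_eq_mul, mul_comm])
  rw [Submonoid.mk_smul, ← Submodule.Quotient.mk_smul, hx, Submodule.Quotient.mk_eq_zero]
  exact Submodule.smul_mem _ _ (Submodule.mem_span_singleton_self z)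

variable {p : ℕ} [Fact p.Prime]

/-- Equal principal ideals of `Λ` have quotients with the same `μ` (transport of the local length at
`(p)` along `Λ/(x) ≃ Λ/(y)`). [cite: Washington1997, §13.2] -/
theorem muInvariant_quotient_congr {x y : IwasawaAlgebra p}
    (h : Ideal.span ({x} : Set (IwasawaAlgebra p)) = Ideal.span {y}) :
    muInvariant p (IwasawaAlgebra p ⧸ Ideal.span {x}) =
      muInvariant p (IwasawaAlgebra p ⧸ Ideal.span {y}) := by
  let 𝔭 : PrimeSpectrum (IwasawaAlgebra p) :=
    ⟨IwasawaAlgebra.augIdealP p, IwasawaAlgebra.isPrime_augIdealP_holds p⟩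
  rw [muInvariant_eq_toNat_lengthAt p _ 𝔭 rfl, muInvariant_eq_toNat_lengthAt p _ 𝔭 rfl,
    Module.lengthAt_eq_of_linearEquiv (Submodule.quotEquivOfEq _ _ h) 𝔭]

/-! ## The common frame of items 19501 / 19865 (CM twin `V` at the quadratic `η`), a twist datum `W`
with pins `I`, `FB`, and a Kobayashi package `P` — section variables -/

section Frame

variable (hp : p ≠ 2) (K₀ : Type) [Field K₀] [NumberField K₀]
  [IsCyclotomicExtension {p} ℚ K₀] [(galRange (K := ℚ) K₀).Normal]
  (η : absoluteGaloisGroup ℚ →* ℤˣ) (hη : ∀ σ ∈ galRange (K := ℚ) K₀, η σ = 1) (hη1 : η ≠ 1)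
  (V : WeierstrassCurve ℚ) [V.IsElliptic] [V.IsGloballyMinimal] {N : ℕ} [NeZero N]
  {f : CuspForm (Gamma0 N) 2} (hCM : V.HasCM) (hgood : V.HasGoodReductionAtPrime p)
  (hap : V.frobeniusTrace p = 0) (hf : IsNewformOf V f) (ϖ : ℚ)
  (hϖ : if Even (p / 2) then (ϖ : ℝ) * V.realPeriodRat = plusPeriod f
    else (ϖ : ℝ) * V.imaginaryPeriodRat = minusPeriod f)
  (κ : ZpExtension ℚ p) (γ : absoluteGaloisGroup ℚ) (hκ : κ.IsCyclotomic) (hγ : κ.IsTopGenerator γ)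
  (hγK : γ ∈ galRange (K := ℚ) K₀) (hvar : IsCyclotomicVariable p γ)
  (W : WeierstrassCurve ℚ) [W.IsElliptic] [ContinuousSMul ℤ_[p] (W.tateModule p)]

include hp hη hη1 hCM hgood hap hf hϖ hκ hγ hγK hvar

section Package

variable (I : Kato2004.IwasawaH1Data W p κ γ) (FB : W.FineSelmerDualData κ γ)
  (P : Kobayashi2003.EtaColemanPoitouTateData p K₀ η V f ϖ κ γ W I FB)

/-! ## §2 The `μ`-bookkeeping of `0 → 𝐇¹_Γ(T_pW)/Λz → Λ/(L_p⁺(V,η,X)) → X⁺(V/K_∞)^η → X₀(W/ℚ_∞) → 0` -/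

/-- **The `μ`-dictionary at `η` on pinned objects (kernel).** Frame of items 19501/19865 (`p ≠ 2`,
`K₀ = ℚ(μ_p)`, `η` the quadratic character, `V` a CM curve, globally minimal, good at `p` with `a_p = 0`,
newform `f`, period ratio `ϖ`, cyclotomic `κ` with generator `γ ∈ Gal(ℚ̄/K₀)` on the cyclotomic variable),
granted the two published inputs `h26` ([BT26] Thm. 2.6 read at `η`) and `h22` ([Kob03] Thm. 2.2 at `η`).
For every curve `W` with a pinned `𝐇¹_Γ(T_pW)` (`I`) and a pinned `X₀(W/ℚ_∞)` (`FB`), every Kobayashi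
package `P` (class `P.z` with `Col⁺(P.z) = L_p⁺(V, η, X)`, (7.21) at `η`), every `Lp` with the
interpolation property of `L_p⁺(V, η, X)` and every plus dual datum `D` of `Sel⁺(V/K_∞)^η`:
`μ(X(D)) + μ(𝐇¹_Γ(T_pW)/Λ·P.z) = μ(Λ/(Lp)) + μ(X₀(W/ℚ_∞))`.
Proof: the four-term sequence `0 → 𝐇¹/Λz → Λ/(Col⁺ z) → X(D) → X₀ → 0`
(`Thm74Skeleton.exists_fourTermExact_of_threeTermExact`), `μ`-additivity
(`BurungaleTian2026.muInvariant_add_eq_of_fourTermExact`; `𝐇¹_Γ` finitely generated by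
`Kato2004.IwasawaH1Data.module_finite_of_isCyclotomic`, `X₀` by `FineSelmerDualData.module_finite`,
torsion by the package; `X(D)` torsion by `h22`; `𝐇¹/Λz` torsion by §1 with `Col⁺ z ≠ 0`, read off
`h26`'s sequence through `BurungaleTian2026.ne_zero_of_fourTermExact_of_isTorsion`), and
`(Col⁺ z) = (Lp)` (`IsQuadraticBranchPlusLFunction.span_singleton_eq`).
[cite: Kobayashi2003, proof of Thm. 7.4 (p. 13), Thm. 7.3 i) (7.21), Thm. 6.3 (p. 11)]
[cite: BurungaleTian2026, Thm. 2.6 and Rem. 2.7 (p. 5)] [cite: Washington1997, §13.2] -/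
theorem muInvariant_add_eq_of_etaColemanPoitouTate
    (h26 : BurungaleTian2026.thm26_etaKatoSequences_charIdeal_upToP_of_cm)
    (h22 : Kobayashi2003.thm22_etaSignedSelmerDual_finite_torsion)
    (Lp : IwasawaAlgebra p) (hLp : Kobayashi2003.IsQuadraticBranchPlusLFunction f p ϖ Lp)
    (D : Kobayashi2003.EtaSignedSelmerDualData V κ K₀ ℚ_[p] η γ 1) :
    muInvariant p D.X + muInvariant p (I.H ⧸ Submodule.span (IwasawaAlgebra p) {P.z}) =
      muInvariant p (IwasawaAlgebra p ⧸ Ideal.span {Lp}) + muInvariant p FB.X := by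
  -- torsion of `X(D)` ([Kob03] Thm. 2.2 at `η`)
  have hXt : Module.IsTorsion (IwasawaAlgebra p) D.X :=
    (h22 p K₀ η hη V hp hgood hap κ γ hκ hγ hγK 1 D).2
  -- `L_p⁺ ≠ 0`, read off [BT26]'s four-term sequence (its left end `A` is torsion)
  obtain ⟨A, B, _, _, _, _, ⟨_, hAtors⟩, -, -, ⟨Lp₀, hLp₀, hSp⟩, -⟩ :=
    h26 p K₀ η hη hη1 V hp hCM hgood hap hf ϖ hϖ κ γ hκ hγ hγK hvar
  obtain ⟨i₀, j₀, k₀, -, hij₀, -, -⟩ := hSp D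
  have hLp₀0 : Lp₀ ≠ 0 :=
    BurungaleTian2026.ne_zero_of_fourTermExact_of_isTorsion hAtors hXt i₀ j₀ hij₀
  have hspan₀ : Ideal.span {P.colPlus P.z} = Ideal.span {Lp₀} :=
    Kobayashi2003.IsQuadraticBranchPlusLFunction.span_singleton_eq hp P.isPlus_colPlus_z hLp₀
  have hspan : Ideal.span {P.colPlus P.z} = Ideal.span {Lp} :=
    Kobayashi2003.IsQuadraticBranchPlusLFunction.span_singleton_eq hp P.isPlus_colPlus_z hLp
  have hcz : P.colPlus P.z ≠ 0 := by
    intro h0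
    apply hLp₀0
    rw [h0] at hspan₀
    exact Ideal.span_singleton_eq_bot.mp (hspan₀.symm.trans (Ideal.span_singleton_eq_bot.mpr rfl))
  -- the four-term sequence at Kobayashi's class `P.z`
  obtain ⟨j, k, hcj, hjk, hk⟩ := P.exact_plus D
  obtain ⟨i, j', k', hi, hij, hjk', hk'⟩ :=
    Thm74Skeleton.exists_fourTermExact_of_threeTermExact P.colPlus j k P.colPlus_injective hcj hjk hk
      P.z
  -- side conditions: finite generation and torsion of the two ends
  haveI : Module.Finite (IwasawaAlgebra p) I.H :=
    Kato2004.IwasawaH1Data.module_finite_of_isCyclotomic hκ hγ I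
  haveI : Module.Finite (IwasawaAlgebra p) FB.X :=
    WeierstrassCurve.FineSelmerDualData.module_finite W κ hγ FB
  have hAt : Module.IsTorsion (IwasawaAlgebra p) (I.H ⧸ Submodule.span (IwasawaAlgebra p) {P.z}) :=
    isTorsion_quotient_span_of_injective_of_ne_zero P.colPlus P.colPlus_injective hcz
  have e := BurungaleTian2026.muInvariant_add_eq_of_fourTermExact hAt P.isTorsion_fine hXt i j' k' hi
    hij hjk' hk'
  rw [muInvariant_quotient_congr hspan] at e
  omega

/-! ## §3 The dictionary: 19865's conclusion ⟺ the Kato-currency `μ`-equality for `W` at Kobayashi's class -/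

/-- **Pointwise dictionary (kernel).** Same frame and hypotheses as
`muInvariant_add_eq_of_etaColemanPoitouTate`: `μ(X(D)) = μ(Λ/(Lp))` — the conclusion of item 19865
`PlusMCEtaKMuPart` at `(Lp, D)` — holds iff `μ(X₀(W/ℚ_∞)) = μ(𝐇¹_Γ(T_pW)/Λ·P.z)` — the conclusion of
stub 2b `stub_katoMuEqualityIstarZero` read at Kobayashi's class `P.z` (and `FB` over `γ`).
[cite: Kobayashi2003, proof of Thm. 7.4 (p. 13)] [cite: BurungaleTian2026, Rem. 2.7 (p. 5)]
[cite: Washington1997, §13.2] -/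
theorem muInvariant_eq_iff_fine_muInvariant_eq
    (h26 : BurungaleTian2026.thm26_etaKatoSequences_charIdeal_upToP_of_cm)
    (h22 : Kobayashi2003.thm22_etaSignedSelmerDual_finite_torsion)
    (Lp : IwasawaAlgebra p) (hLp : Kobayashi2003.IsQuadraticBranchPlusLFunction f p ϖ Lp)
    (D : Kobayashi2003.EtaSignedSelmerDualData V κ K₀ ℚ_[p] η γ 1) :
    muInvariant p D.X = muInvariant p (IwasawaAlgebra p ⧸ Ideal.span {Lp}) ↔
      muInvariant p FB.X = muInvariant p (I.H ⧸ Submodule.span (IwasawaAlgebra p) {P.z}) := by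
  have e := muInvariant_add_eq_of_etaColemanPoitouTate hp K₀ η hη hη1 V hCM hgood hap hf ϖ hϖ κ γ hκ hγ
    hγK hvar W I FB P h26 h22 Lp hLp D
  omega

/-- **BY NAME from the route file: 19867 `PublishedInputsEtaUpToP` → 19865 `PlusMCEtaKMuPart` → the
Kato-currency `μ`-equality for the twist `W` AT KOBAYASHI'S CLASS.** For every CM frame of 19865, every
`W` with pins `I`, `FB` (over `γ`) and every Kobayashi package `P`:
`μ(X₀(W/ℚ_∞)) = μ(𝐇¹_Γ(T_pW)/Λ·P.z)`. (A plus datum to feed 19865 exists by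
`Additive.nonempty_etaSignedSelmerDualData_cyclotomic`; the route's `Additive.` objects are transported to
the Literature copies field for field.) 19865 is OPEN; nothing is asserted unconditionally.
[cite: Kobayashi2003, proof of Thm. 7.4 (p. 13), §4 (p. 8)] [cite: BurungaleTian2026, Rem. 2.7 (p. 5)] -/
theorem fine_muInvariant_eq_of_plusMCEtaKMuPart (hF : PublishedInputsEtaUpToP)
    (hμ : PlusMCEtaKMuPart) :
    muInvariant p FB.X = muInvariant p (I.H ⧸ Submodule.span (IwasawaAlgebra p) {P.z}) := by
  obtain ⟨h26, h22⟩ := hF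
  obtain ⟨Dₐ⟩ := Additive.nonempty_etaSignedSelmerDualData_cyclotomic V κ K₀ ℚ_[p] η (1 : ℤˣ) hγ hγK
  -- the route's pinning predicate IS the Literature one (`Iff.rfl`); the dual datum transports field for field
  have hLpA : Additive.IsQuadraticBranchPlusLFunction f p ϖ (P.colPlus P.z) := P.isPlus_colPlus_z
  let D : Kobayashi2003.EtaSignedSelmerDualData V κ K₀ ℚ_[p] η γ 1 :=
    ⟨Dₐ.X, Dₐ.conj_mem, Dₐ.toDual, Dₐ.bijective, Dₐ.toDual_T_smul, Dₐ.toDual_C_smul⟩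
  have h19865 : muInvariant p Dₐ.X =
      muInvariant p (IwasawaAlgebra p ⧸ Ideal.span {P.colPlus P.z}) :=
    hμ p hp K₀ η hη hη1 V hCM hgood hap hf ϖ hϖ κ γ hκ hγ hγK hvar (P.colPlus P.z) hLpA Dₐ
  exact (muInvariant_eq_iff_fine_muInvariant_eq hp K₀ η hη hη1 V hCM hgood hap hf ϖ hϖ κ γ hκ hγ hγK hvar
    W I FB P h26 h22 (P.colPlus P.z) P.isPlus_colPlus_z D).mp h19865

/-- **The same from the registered ROUTE-CRUX stub `stub_plusMCEtaK` = item 19501 `PlusMCEtaK`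
verbatim** (its `μ`-part through the kernel `μ`-criterion
`PlusMCEtaKUpToMu.plusMCEtaK_iff_muInvariant_eq_of_burungaleTian`, granted 19867): for every CM frame,
every `W` with pins `I`, `FB` and every package `P`, `μ(X₀(W/ℚ_∞)) = μ(𝐇¹_Γ(T_pW)/Λ·P.z)`.
[cite: Kobayashi2003, proof of Thm. 7.4 (p. 13), §4 (p. 8)] [cite: BurungaleTian2026, Thm. 2.6 and Rem. 2.7 (p. 5)] -/
theorem fine_muInvariant_eq_of_plusMCEtaK (hF : PublishedInputsEtaUpToP) (hK : PlusMCEtaK) :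
    muInvariant p FB.X = muInvariant p (I.H ⧸ Submodule.span (IwasawaAlgebra p) {P.z}) := by
  obtain ⟨h26, h22⟩ := hF
  obtain ⟨Dₐ⟩ := Additive.nonempty_etaSignedSelmerDualData_cyclotomic V κ K₀ ℚ_[p] η (1 : ℤˣ) hγ hγK
  have hLpA : Additive.IsQuadraticBranchPlusLFunction f p ϖ (P.colPlus P.z) := P.isPlus_colPlus_z
  let D : Kobayashi2003.EtaSignedSelmerDualData V κ K₀ ℚ_[p] η γ 1 :=
    ⟨Dₐ.X, Dₐ.conj_mem, Dₐ.toDual, Dₐ.bijective, Dₐ.toDual_T_smul, Dₐ.toDual_C_smul⟩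
  have hchar : Dₐ.charIdeal = Ideal.span {P.colPlus P.z} :=
    hK p hp K₀ η hη hη1 V hCM hgood hap hf ϖ hϖ κ γ hκ hγ hγK hvar (P.colPlus P.z) hLpA Dₐ
  have h19865 : muInvariant p Dₐ.X =
      muInvariant p (IwasawaAlgebra p ⧸ Ideal.span {P.colPlus P.z}) :=
    (PlusMCEtaKUpToMu.plusMCEtaK_iff_muInvariant_eq_of_burungaleTian h26 h22 p hp K₀ η hη hη1 V hCM
      hgood hap hf ϖ hϖ κ γ hκ hγ hγK hvar (P.colPlus P.z) hLpA Dₐ).mp hchar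
  exact (muInvariant_eq_iff_fine_muInvariant_eq hp K₀ η hη hη1 V hCM hgood hap hf ϖ hϖ κ γ hκ hγ hγK hvar
    W I FB P h26 h22 (P.colPlus P.z) P.isPlus_colPlus_z D).mp h19865

/-- **Converse packaging: the Kato-currency `μ`-equality at Kobayashi's class gives 19865's conclusion
pointwise.** Same CM frame, granted 19867: if `μ(X₀(W/ℚ_∞)) = μ(𝐇¹_Γ(T_pW)/Λ·P.z)` for ONE package
`P` on ONE twist datum `(W, I, FB)`, then `μ(X(D)) = μ(Λ/(Lp))` for every `Lp` with the interpolation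
property and every plus datum `D` of the route's own type (`Additive.EtaSignedSelmerDualData … γ 1`).
[cite: Kobayashi2003, proof of Thm. 7.4 (p. 13), §4 (p. 8)] [cite: BurungaleTian2026, Rem. 2.7 (p. 5)] -/
theorem plusEta_muInvariant_eq_of_fine_muInvariant_eq (hF : PublishedInputsEtaUpToP)
    (hfine : muInvariant p FB.X = muInvariant p (I.H ⧸ Submodule.span (IwasawaAlgebra p) {P.z}))
    (Lp : IwasawaAlgebra p) (hLp : Additive.IsQuadraticBranchPlusLFunction f p ϖ Lp)
    (Dₐ : Additive.EtaSignedSelmerDualData V κ K₀ ℚ_[p] η γ 1) :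
    muInvariant p Dₐ.X = muInvariant p (IwasawaAlgebra p ⧸ Ideal.span {Lp}) := by
  obtain ⟨h26, h22⟩ := hF
  have hLp' : Kobayashi2003.IsQuadraticBranchPlusLFunction f p ϖ Lp := hLp
  let D : Kobayashi2003.EtaSignedSelmerDualData V κ K₀ ℚ_[p] η γ 1 :=
    ⟨Dₐ.X, Dₐ.conj_mem, Dₐ.toDual, Dₐ.bijective, Dₐ.toDual_T_smul, Dₐ.toDual_C_smul⟩
  exact (muInvariant_eq_iff_fine_muInvariant_eq hp K₀ η hη hη1 V hCM hgood hap hf ϖ hϖ κ γ hκ hγ hγK hvar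
    W I FB P h26 h22 Lp hLp' D).mpr hfine

/-! ## §4 The `Module.lengthAt … (p)` currency of stub 2b -/

/-- **Stub 2b's sentence AT KOBAYASHI'S CLASS, in stub 2b's own currency (kernel, by name from the
route).** Granted 19867 `PublishedInputsEtaUpToP` and 19865 `PlusMCEtaKMuPart`: for every CM frame,
every `W` with pins `I`, `FB` (over `γ`), every Kobayashi package `P` and every prime `𝔮` of `Λ` with
`𝔮 = (p)`: `length_𝔮 X₀(W/ℚ_∞) = length_𝔮 (𝐇¹_Γ(T_pW) ⧸ Λ∙P.z)` — compare
`KatoPerrinRiouIstar.stub_katoMuEqualityIstarZero`, whose class is an ADMISSIBLE `z₀` and whose `X₀` datum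
is over `γ⁻¹`. Both lengths are finite (finitely generated torsion modules), so the `μ`-equality of §3
lifts. [cite: Kato2004Asterisque, Conj. 12.10 (p. 224)] [cite: Kobayashi2003, proof of Thm. 7.4 (p. 13)]
[cite: BurungaleTian2026, Rem. 2.7 (p. 5)] -/
theorem lengthAt_fine_eq_lengthAt_quotient_of_plusMCEtaKMuPart (hF : PublishedInputsEtaUpToP)
    (hμ : PlusMCEtaKMuPart)
    (𝔮 : PrimeSpectrum (IwasawaAlgebra p)) (h𝔮 : 𝔮.asIdeal = IwasawaAlgebra.augIdealP p) :
    Module.lengthAt (IwasawaAlgebra p) FB.X 𝔮 =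
      Module.lengthAt (IwasawaAlgebra p) (I.H ⧸ Submodule.span (IwasawaAlgebra p) {P.z}) 𝔮 := by
  have hμeq := fine_muInvariant_eq_of_plusMCEtaKMuPart hp K₀ η hη hη1 V hCM hgood hap hf ϖ hϖ κ γ hκ hγ
    hγK hvar W I FB P hF hμ
  obtain ⟨h26, h22⟩ := hF
  -- `Col⁺ z ≠ 0` as in §2, for the torsion of `𝐇¹/Λz`
  obtain ⟨Dₐ⟩ := Additive.nonempty_etaSignedSelmerDualData_cyclotomic V κ K₀ ℚ_[p] η (1 : ℤˣ) hγ hγK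
  let D : Kobayashi2003.EtaSignedSelmerDualData V κ K₀ ℚ_[p] η γ 1 :=
    ⟨Dₐ.X, Dₐ.conj_mem, Dₐ.toDual, Dₐ.bijective, Dₐ.toDual_T_smul, Dₐ.toDual_C_smul⟩
  have hXt : Module.IsTorsion (IwasawaAlgebra p) D.X :=
    (h22 p K₀ η hη V hp hgood hap κ γ hκ hγ hγK 1 D).2
  obtain ⟨A, B, _, _, _, _, ⟨_, hAtors⟩, -, -, ⟨Lp₀, hLp₀, hSp⟩, -⟩ :=
    h26 p K₀ η hη hη1 V hp hCM hgood hap hf ϖ hϖ κ γ hκ hγ hγK hvar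
  obtain ⟨i₀, j₀, k₀, -, hij₀, -, -⟩ := hSp D
  have hLp₀0 : Lp₀ ≠ 0 :=
    BurungaleTian2026.ne_zero_of_fourTermExact_of_isTorsion hAtors hXt i₀ j₀ hij₀
  have hspan₀ : Ideal.span {P.colPlus P.z} = Ideal.span {Lp₀} :=
    Kobayashi2003.IsQuadraticBranchPlusLFunction.span_singleton_eq hp P.isPlus_colPlus_z hLp₀
  have hcz : P.colPlus P.z ≠ 0 := by
    intro h0
    apply hLp₀0
    rw [h0] at hspan₀
    exact Ideal.span_singleton_eq_bot.mp (hspan₀.symm.trans (Ideal.span_singleton_eq_bot.mpr rfl))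
  haveI : Module.Finite (IwasawaAlgebra p) I.H :=
    Kato2004.IwasawaH1Data.module_finite_of_isCyclotomic hκ hγ I
  haveI : Module.Finite (IwasawaAlgebra p) FB.X :=
    WeierstrassCurve.FineSelmerDualData.module_finite W κ hγ FB
  have hAt : Module.IsTorsion (IwasawaAlgebra p) (I.H ⧸ Submodule.span (IwasawaAlgebra p) {P.z}) :=
    isTorsion_quotient_span_of_injective_of_ne_zero P.colPlus P.colPlus_injective hcz
  have hB := lengthAt_ne_top_of_isTorsion p FB.X P.isTorsion_fine 𝔮 h𝔮
  have hA := lengthAt_ne_top_of_isTorsion p (I.H ⧸ Submodule.span (IwasawaAlgebra p) {P.z}) hAt 𝔮 h𝔮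
  rw [muInvariant_eq_toNat_lengthAt p _ 𝔮 h𝔮, muInvariant_eq_toNat_lengthAt p _ 𝔮 h𝔮] at hμeq
  rw [← ENat.coe_toNat hB, ← ENat.coe_toNat hA, hμeq]

/-! ## §5 Stub 2b's own binders: the contragredient `X₀` (key `γ⁻¹`) and the class supplied by the named fact -/

/-- **Stub 2b's sentence in stub 2b's currency and keying, the admissible class replaced by Kobayashi's
(kernel, by name from the route).** Granted 19867 `PublishedInputsEtaUpToP` and 19865 `PlusMCEtaKMuPart`:
for every CM frame, every `W` with pin `I`, every `FB : W.FineSelmerDualData κ γ` with a Kobayashi package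
`P`, every CONTRAGREDIENT dual fine Selmer datum `Y : W.FineSelmerDualData κ γ⁻¹` (the `Y` of
`KatoPerrinRiouIstar.stub_katoMuEqualityIstarZero`) and every prime `𝔮 = (p)` of `Λ`:
`length_𝔮 Y.X = length_𝔮 (𝐇¹_Γ(T_pW) ⧸ Λ∙P.z)`. The re-keying `γ ↦ γ⁻¹` of `X₀` is the `ι`-twist
(`Kato2004.fineSelmerDualData_lengthAt_inv_eq`) and `ι` fixes `(p)`
(`IwasawaAlgebra.comap_invol_eq_self_of_asIdeal_eq_augIdealP`), so §4 transports verbatim.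
[cite: Kato2004Asterisque, Conj. 12.10 (p. 224)] [cite: GreenbergLNM1716, §1 p. 60]
[cite: Kobayashi2003, proof of Thm. 7.4 (p. 13)] [cite: BurungaleTian2026, Rem. 2.7 (p. 5)] -/
theorem lengthAt_contra_fine_eq_lengthAt_quotient_of_plusMCEtaKMuPart (hF : PublishedInputsEtaUpToP)
    (hμ : PlusMCEtaKMuPart)
    (Y : W.FineSelmerDualData κ γ⁻¹)
    (𝔮 : PrimeSpectrum (IwasawaAlgebra p)) (h𝔮 : 𝔮.asIdeal = IwasawaAlgebra.augIdealP p) :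
    Module.lengthAt (IwasawaAlgebra p) Y.X 𝔮 =
      Module.lengthAt (IwasawaAlgebra p) (I.H ⧸ Submodule.span (IwasawaAlgebra p) {P.z}) 𝔮 := by
  rw [Kato2004.fineSelmerDualData_lengthAt_inv_eq FB Y 𝔮,
    IwasawaAlgebra.comap_invol_eq_self_of_asIdeal_eq_augIdealP p 𝔮 h𝔮]
  exact lengthAt_fine_eq_lengthAt_quotient_of_plusMCEtaKMuPart hp K₀ η hη hη1 V hCM hgood hap hf ϖ hϖ κ γ
    hκ hγ hγK hvar W I FB P hF hμ 𝔮 h𝔮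

end Package

/-- **Keyed to the named fact `Kobayashi2003.thm62_63_73_etaColemanPoitouTate` (Kobayashi 2003 Thm.
6.2/6.3/7.3 i)/Cor. 7.2 at `η` on pinned objects): granted it, 19867 and 19865, for every CM frame, every
model `W` of the quadratic twist `V^{(p*)}` (`C • W.quadraticTwist p* = V`) and every pin
`I : 𝐇¹_Γ(T_pW)`, SOME class `z ∈ 𝐇¹_Γ(T_pW)` — a Kobayashi `η`-class (`Col⁺ z = L_p⁺(V, η, X)` for some
package) — satisfies stub 2b's sentence for EVERY contragredient `Y` at `𝔮 = (p)`.** Compare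
`KatoPerrinRiouIstar.stub_katoMuEqualityIstarZero`: «for every ADMISSIBLE `z₀`». The residual content of
stub 2b on a row carrying this frame is therefore «`μ(𝐇¹_Γ/Λz₀) = μ(𝐇¹_Γ/Λz)` for every admissible `z₀`»
(e.g. `z₀ ∈ Λˣ·z`) — NOT asserted.
A key-`γ` datum `FB` exists by `WeierstrassCurve.nonempty_fineSelmerDualData`.
[cite: Kobayashi2003, Thm. 6.2–6.3 (p. 11), Thm. 7.3 i) (7.21), Cor. 7.2 and proof of Thm. 7.4 (p. 13)]
[cite: Kato2004Asterisque, Conj. 12.10 (p. 224)] [cite: BurungaleTian2026, Rem. 2.7 (p. 5)] -/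
theorem exists_kobayashiClass_lengthAt_contra_fine_eq_of_plusMCEtaKMuPart (hF : PublishedInputsEtaUpToP)
    (hμ : PlusMCEtaKMuPart) (hT : Kobayashi2003.thm62_63_73_etaColemanPoitouTate)
    (C : VariableChange ℚ) (hW : C • W.quadraticTwist ((-1) ^ (p / 2) * p) = V)
    (I : Kato2004.IwasawaH1Data W p κ γ) :
    ∃ z : I.H,
      (∃ (FB : W.FineSelmerDualData κ γ)
          (P : Kobayashi2003.EtaColemanPoitouTateData p K₀ η V f ϖ κ γ W I FB), P.z = z) ∧
      ∀ (Y : W.FineSelmerDualData κ γ⁻¹) (𝔮 : PrimeSpectrum (IwasawaAlgebra p)),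
        𝔮.asIdeal = IwasawaAlgebra.augIdealP p →
          Module.lengthAt (IwasawaAlgebra p) Y.X 𝔮 =
            Module.lengthAt (IwasawaAlgebra p) (I.H ⧸ Submodule.span (IwasawaAlgebra p) {z}) 𝔮 := by
  obtain ⟨FB⟩ := W.nonempty_fineSelmerDualData κ hγ
  obtain ⟨P⟩ := hT p K₀ η hη hη1 V hp hgood hap hf ϖ hϖ κ γ hκ hγ hγK hvar W C hW I FB
  exact ⟨P.z, ⟨FB, P, rfl⟩, fun Y 𝔮 h𝔮 =>
    lengthAt_contra_fine_eq_lengthAt_quotient_of_plusMCEtaKMuPart hp K₀ η hη hη1 V hCM hgood hap hf ϖ hϖ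
      κ γ hκ hγ hγK hvar W I FB P hF hμ Y 𝔮 h𝔮⟩

end Frame

end Summit.BirchSwinnertonDyer.BirchSwinnertonDyer.Theorems.CccOneMuDictionaryEta

end
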